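import Summits.CriticalPhenomena.PercolationContinuityZ3.Theorems.PercNearOneGluingNoHeavyQuantGluedTwoRowDual
import HarnessLib

/-!
# QUANT lane R8, T-DEC: the TWO-COLUMN dual criterion, order-free — any number of rows shipping to two priced columns: the transport
# inequality holds for all prices iff it holds at the kink of every row (arm-1 gen 59, architect)

builds on p205010 (kernel theorem, internal audit signed; external expert review pending)

Support file (`--supports stmt-CriticalPhenomena-4575`), QUANT lane seat prim-quant-arm-1 (gen 59); memo `run/shared/lean/prim/quant/prim-quant-arm-1-g59/ARCH-G59.md`
§7.  Pure real algebra, no definitions; standard axioms, no sorries.  `GluedWindow.twoCol_breakpoint` (`…QuantGluedWindowIneq`) needs its three rows SORTED by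
the ratio of their two rates; here the same criterion is derived for a `Finset` of rows with NO order hypothesis, as a corollary of the two-row kink lemma
`GluedWindow.twoRow_kinks` (`…QuantGluedTwoRowDual`) through `min = sum − max`: rows `s` (weights `w s ≥ 0`, rates `κ s, m s ≥ 0` into the columns `A`, `P`),
`Σ_s w s · min(κ s·pA, m s·pP) ≤ a·pA + b·pP` for all prices `pA, pP ≥ 0` as soon as `0 ≤ a`, `0 ≤ b` and, for every row `s'`, the kink check
`Σ_s w s · min(κ s · m s', m s · κ s') ≤ a · m s' + b · κ s'` (**`twoCol_kinks`**); with row values `v s ≤ κ s·pA`, `v s ≤ m s·pP` this bounds `Σ w s · v s`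
(**`twoCol_dual`**, explicit three- and four-row forms **`twoCol_dual_three`**, **`twoCol_dual_four`**).  Use (memo §7): the `h`-low half of the two-row regime of
LEMMA W is a two-column problem — rows `l, l+r, h (, h+r)`, columns `l+r+k` and the giants at the floor rate — by the survey kit job j297905 (`nodisc_L2 = n`).

HONEST STATUS.  `GluedLemmaW` (flow form), `GluedDominatedMass`, the band, `SiblingStep`, `FarTreeRow` OPEN; RATE class (log\*) / honest sentence of
`run/shared/lean/prim/quant/README.md` unchanged.  [this work] — elementary, [folklore].  Nothing here is cited as a published result.  The gluing rows
served [cite: KozmaNitzan2024, Conjecture 3 (p. 15)]; product measure [cite: Grimmett1999, §1.3 p. 10].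
-/

namespace Summit.CriticalPhenomena.PercolationContinuityZ3.Theorems
namespace Quant
namespace LawDec
namespace GluedWindow

open Finset

variable {ι : Type*}

/-- **TWO COLUMNS, ANY ROWS — KINK FORM.**  Rows `s ∈ S` with weights `w s ≥ 0` and rates `κ s, m s ≥ 0` into two columns priced `pA, pP ≥ 0` with linear
right side `a·pA + b·pP`, `a, b ≥ 0`: if the kink of every row checks, `Σ_s w s · min(κ s·pA, m s·pP) ≤ a·pA + b·pP`. [folklore] -/
theorem twoCol_kinks [DecidableEq ι] (S : Finset ι) (w κ m : ι → ℝ) (hw : ∀ s ∈ S, 0 ≤ w s) (hκ : ∀ s ∈ S, 0 ≤ κ s) (hm : ∀ s ∈ S, 0 ≤ m s)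
    (a b : ℝ) (ha : 0 ≤ a) (hb : 0 ≤ b)
    (hk : ∀ s' ∈ S, ∑ s ∈ S, w s * min (κ s * m s') (m s * κ s') ≤ a * m s' + b * κ s')
    (pA pP : ℝ) (hpA : 0 ≤ pA) (hpP : 0 ≤ pP) :
    ∑ s ∈ S, w s * min (κ s * pA) (m s * pP) ≤ a * pA + b * pP := by
  -- min = sum − max, and the two-row kink lemma with w0 = Σ w κ − a, w1 = Σ w m − b, c = w, i = κ, j = m
  have key := twoRow_kinks S w κ m hw hκ hm ((∑ s ∈ S, w s * κ s) - a) ((∑ s ∈ S, w s * m s) - b) (by linarith) (by linarith) ?_ pA pP hpA hpP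
  · have e : ∑ s ∈ S, w s * min (κ s * pA) (m s * pP)
        = pA * ∑ s ∈ S, w s * κ s + pP * ∑ s ∈ S, w s * m s - ∑ s ∈ S, w s * max (pA * κ s) (pP * m s) := by
      rw [Finset.mul_sum, Finset.mul_sum, ← Finset.sum_add_distrib, ← Finset.sum_sub_distrib]
      refine Finset.sum_congr rfl fun s _ => ?_
      have := min_add_max (κ s * pA) (m s * pP)
      rw [mul_comm pA (κ s), mul_comm pP (m s)]
      have e2 : pA * (w s * κ s) + pP * (w s * m s) = w s * (κ s * pA + m s * pP) := by ring
      rw [e2, ← mul_sub]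
      congr 1; linarith
    rw [e]; nlinarith [key]
  · intro s' hs'
    have e : ∑ s ∈ S, w s * max (m s' * κ s) (κ s' * m s)
        = m s' * ∑ s ∈ S, w s * κ s + κ s' * ∑ s ∈ S, w s * m s - ∑ s ∈ S, w s * min (κ s * m s') (m s * κ s') := by
      rw [Finset.mul_sum, Finset.mul_sum, ← Finset.sum_add_distrib, ← Finset.sum_sub_distrib]
      refine Finset.sum_congr rfl fun s _ => ?_
      have := min_add_max (κ s * m s') (m s * κ s')
      rw [mul_comm (m s') (κ s), mul_comm (κ s') (m s)]
      have e2 : m s' * (w s * κ s) + κ s' * (w s * m s) = w s * (κ s * m s' + m s * κ s') := by ring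
      rw [e2, ← mul_sub]
      congr 1; linarith
    rw [e]; nlinarith [hk s' hs']

/-- **TWO COLUMNS, ANY ROWS — THE DUAL INEQUALITY.**  With row values `v s ≤ κ s·pA` and `v s ≤ m s·pP` (any sign) and weights `w s ≥ 0`:
`Σ_s w s · v s ≤ a·pA + b·pP` from the kink checks. [this work] -/
theorem twoCol_dual [DecidableEq ι] (S : Finset ι) (w κ m v : ι → ℝ) (hw : ∀ s ∈ S, 0 ≤ w s) (hκ : ∀ s ∈ S, 0 ≤ κ s) (hm : ∀ s ∈ S, 0 ≤ m s)
    (a b pA pP : ℝ) (ha : 0 ≤ a) (hb : 0 ≤ b) (hpA : 0 ≤ pA) (hpP : 0 ≤ pP)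
    (hvA : ∀ s ∈ S, v s ≤ κ s * pA) (hvP : ∀ s ∈ S, v s ≤ m s * pP)
    (hk : ∀ s' ∈ S, ∑ s ∈ S, w s * min (κ s * m s') (m s * κ s') ≤ a * m s' + b * κ s') :
    ∑ s ∈ S, w s * v s ≤ a * pA + b * pP := by
  have h1 : ∑ s ∈ S, w s * v s ≤ ∑ s ∈ S, w s * min (κ s * pA) (m s * pP) :=
    Finset.sum_le_sum fun s hs => mul_le_mul_of_nonneg_left (le_min (hvA s hs) (hvP s hs)) (hw s hs)
  exact le_trans h1 (twoCol_kinks S w κ m hw hκ hm a b ha hb hk pA pP hpA hpP)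

/-- `twoCol_dual` for THREE explicit rows (weights `w0,w1,w2`, rates `(κ0,m0),(κ1,m1),(κ2,m2)`, values `v0,v1,v2`), NO order hypothesis on the rows
(compare `twoCol_breakpoint`). [this work] -/
theorem twoCol_dual_three (w0 w1 w2 κ0 κ1 κ2 m0 m1 m2 v0 v1 v2 a b pA pP : ℝ) (hw0 : 0 ≤ w0) (hw1 : 0 ≤ w1) (hw2 : 0 ≤ w2)
    (hκ0 : 0 ≤ κ0) (hκ1 : 0 ≤ κ1) (hκ2 : 0 ≤ κ2) (hm0 : 0 ≤ m0) (hm1 : 0 ≤ m1) (hm2 : 0 ≤ m2)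
    (ha : 0 ≤ a) (hb : 0 ≤ b) (hpA : 0 ≤ pA) (hpP : 0 ≤ pP)
    (h0A : v0 ≤ κ0 * pA) (h1A : v1 ≤ κ1 * pA) (h2A : v2 ≤ κ2 * pA) (h0P : v0 ≤ m0 * pP) (h1P : v1 ≤ m1 * pP) (h2P : v2 ≤ m2 * pP)
    (hk0 : w0 * min (κ0 * m0) (m0 * κ0) + w1 * min (κ1 * m0) (m1 * κ0) + w2 * min (κ2 * m0) (m2 * κ0) ≤ a * m0 + b * κ0)
    (hk1 : w0 * min (κ0 * m1) (m0 * κ1) + w1 * min (κ1 * m1) (m1 * κ1) + w2 * min (κ2 * m1) (m2 * κ1) ≤ a * m1 + b * κ1)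
    (hk2 : w0 * min (κ0 * m2) (m0 * κ2) + w1 * min (κ1 * m2) (m1 * κ2) + w2 * min (κ2 * m2) (m2 * κ2) ≤ a * m2 + b * κ2) :
    w0 * v0 + w1 * v1 + w2 * v2 ≤ a * pA + b * pP := by
  have key := twoCol_dual (Finset.univ : Finset (Fin 3)) ![w0, w1, w2] ![κ0, κ1, κ2] ![m0, m1, m2] ![v0, v1, v2]
    (by intro s _; fin_cases s <;> assumption) (by intro s _; fin_cases s <;> assumption) (by intro s _; fin_cases s <;> assumption)
    a b pA pP ha hb hpA hpP (by intro s _; fin_cases s <;> assumption) (by intro s _; fin_cases s <;> assumption)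
    (by intro s' _; fin_cases s' <;> simp [Fin.sum_univ_three] <;> assumption)
  simpa [Fin.sum_univ_three] using key

/-- `twoCol_dual` for FOUR explicit rows (the `h`-low cells of the two-row regime of LEMMA W: rows `l, l+r, h, h+r`; columns `l+r+k` and the giants). [this work] -/
theorem twoCol_dual_four (w0 w1 w2 w3 κ0 κ1 κ2 κ3 m0 m1 m2 m3 v0 v1 v2 v3 a b pA pP : ℝ) (hw0 : 0 ≤ w0) (hw1 : 0 ≤ w1) (hw2 : 0 ≤ w2) (hw3 : 0 ≤ w3)
    (hκ0 : 0 ≤ κ0) (hκ1 : 0 ≤ κ1) (hκ2 : 0 ≤ κ2) (hκ3 : 0 ≤ κ3) (hm0 : 0 ≤ m0) (hm1 : 0 ≤ m1) (hm2 : 0 ≤ m2) (hm3 : 0 ≤ m3)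
    (ha : 0 ≤ a) (hb : 0 ≤ b) (hpA : 0 ≤ pA) (hpP : 0 ≤ pP)
    (h0A : v0 ≤ κ0 * pA) (h1A : v1 ≤ κ1 * pA) (h2A : v2 ≤ κ2 * pA) (h3A : v3 ≤ κ3 * pA)
    (h0P : v0 ≤ m0 * pP) (h1P : v1 ≤ m1 * pP) (h2P : v2 ≤ m2 * pP) (h3P : v3 ≤ m3 * pP)
    (hk0 : w0 * min (κ0 * m0) (m0 * κ0) + w1 * min (κ1 * m0) (m1 * κ0) + w2 * min (κ2 * m0) (m2 * κ0) + w3 * min (κ3 * m0) (m3 * κ0) ≤ a * m0 + b * κ0)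
    (hk1 : w0 * min (κ0 * m1) (m0 * κ1) + w1 * min (κ1 * m1) (m1 * κ1) + w2 * min (κ2 * m1) (m2 * κ1) + w3 * min (κ3 * m1) (m3 * κ1) ≤ a * m1 + b * κ1)
    (hk2 : w0 * min (κ0 * m2) (m0 * κ2) + w1 * min (κ1 * m2) (m1 * κ2) + w2 * min (κ2 * m2) (m2 * κ2) + w3 * min (κ3 * m2) (m3 * κ2) ≤ a * m2 + b * κ2)
    (hk3 : w0 * min (κ0 * m3) (m0 * κ3) + w1 * min (κ1 * m3) (m1 * κ3) + w2 * min (κ2 * m3) (m2 * κ3) + w3 * min (κ3 * m3) (m3 * κ3) ≤ a * m3 + b * κ3) :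
    w0 * v0 + w1 * v1 + w2 * v2 + w3 * v3 ≤ a * pA + b * pP := by
  have key := twoCol_dual (Finset.univ : Finset (Fin 4)) ![w0, w1, w2, w3] ![κ0, κ1, κ2, κ3] ![m0, m1, m2, m3] ![v0, v1, v2, v3]
    (by intro s _; fin_cases s <;> assumption) (by intro s _; fin_cases s <;> assumption) (by intro s _; fin_cases s <;> assumption)
    a b pA pP ha hb hpA hpP (by intro s _; fin_cases s <;> assumption) (by intro s _; fin_cases s <;> assumption)
    (by intro s' _; fin_cases s' <;> simp [Fin.sum_univ_four] <;> assumption)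
  simpa [Fin.sum_univ_four] using key

end GluedWindow
end LawDec
end Quant
end Summit.CriticalPhenomena.PercolationContinuityZ3.Theorems
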